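import Summits.QuantumFields.YangMills.Theorems.FlatTubeReductionFibredBOCross
import Summits.QuantumFields.YangMills.Theorems.FlatTubeReductionFibredBOKernel
import HarnessLib

/-!
# Fibred Born–Oppenheimer blocks — part 6: the transport defect is a Gram form of the weighted-profile difference (⇒ an `L²`-Lipschitz bound)
# (route `FlatTubeReduction`, crux K1 `NearFlatRatioLaw` stmt-QuantumFields-24720, registered stub `stub_boRate` = FCL 23943's `BORateAll`;
# rung R2b1 = RECORD-label femto gap; no summit statement is proved here)

Seat `ym-line-ftr-p1` g6 (prover).  The CROSS block (`…FibredBOCross.sq_fibredForm_prod_le_of_orth`) is driven by the TRANSPORT DEFECT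
`transportSq Ω c c' = ‖S_cΩ_c − S_{c'}Ω_{c'}‖²_{L²(ρ)}` of the frozen fibre profile across one kinetic step.  When the half-kernel factors as
`s(c,q,z) = m_c(q)·g(q,z)` with a `c`-INDEPENDENT kinetic half-kernel `g` (the Gaussian case of `…FibredBOGaussian`), the defect is the quadratic form of the
kinetic Gram kernel `G(q,q') = ∫ g(q,z)g(q',z)dρ` on the DIFFERENCE of the weighted profiles `d = m_cΩ_c − m_{c'}Ω_{c'}`, hence at most its Schur bound times
`‖d‖²_{L²(π)}`: the CROSS budget `τ` reduces to an `L²(π)`-Lipschitz estimate for `c ↦ m_cΩ_c` along the slow manifold (for Gaussian fibres: Lipschitz dependence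
of the stiffness Hessian `A_c` on `c`) integrated against the one-site kernel's kinetic localisation `∫ k(c,c')|c−c'|² ≲ (L³β)^{-1}`.
* ★ `halfT_sub_halfT_of_mul` — `S_cΩ_c − S_{c'}Ω_{c'} = ∫ g(q,·)·d(q) dπ`;
* ★ `transportSq_eq_form_of_mul` — `transportSq Ω c c' = ∫∫ d(q)·G(q,q')·d(q') dπdπ`;
* ★★ `transportSq_le_of_mul` — `transportSq Ω c c' ≤ M_G·∫ d² dπ` for a row bound `M_G` of the nonnegative symmetric `G` (Schur).
Integrability side conditions are hypotheses.  HONEST FRAMING: bookkeeping for the registered stub of a crux of the CONDITIONAL reduction route to the femto rung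
R2b1 (RECORD label); the chart and the profiles are OPEN (route RED lane A C4-CORE + the rate twin); nothing here is infinite volume, a continuum limit or the
Clay mass gap.  No definitions, no named facts, no `sorry`.

## References
* B. Helffer, *Spectral Theory and its Applications*, CUP 2013, Lemma 7.1 (Schur's test) — [cite: Helffer2013, Lemma 7.1 pp.77–78].
-/

set_option autoImplicit false

noncomputable section

open MeasureTheory

namespace Summit.QuantumFields.YangMills.Theorems.FemtoTransferGap.FibredBO

variable {C Q Z : Type*} [MeasurableSpace C] [MeasurableSpace Q] [MeasurableSpace Z]
variable {π : Measure Q} {ρ : Measure Z} [SFinite π] [SFinite ρ]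
variable {s : C → Q → Z → ℝ} {m : C → Q → ℝ} {g : Q → Z → ℝ} {Ω : C → Q → ℝ}

omit [MeasurableSpace C] [MeasurableSpace Z] [SFinite π] [SFinite ρ] in
/-- ★ For a factorised half-kernel `s(c,q,z) = m_c(q)g(q,z)`: `S_cΩ_c(z) − S_{c'}Ω_{c'}(z) = ∫ g(q,z)·(m_c(q)Ω_c(q) − m_{c'}(q)Ω_{c'}(q)) dπ`. [folklore] -/
theorem halfT_sub_halfT_of_mul (hs : ∀ c q z, s c q z = m c q * g q z) (c c' : C) (z : Z)
    (h1 : Integrable (fun q => s c q z * Ω c q) π) (h2 : Integrable (fun q => s c' q z * Ω c' q) π) :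
    halfT π s c (Ω c) z - halfT π s c' (Ω c') z = ∫ q, g q z * (m c q * Ω c q - m c' q * Ω c' q) ∂π := by
  unfold halfT
  rw [← integral_sub h1 h2]
  refine integral_congr_ae (ae_of_all _ fun q => ?_)
  simp only [hs]
  ring

omit [MeasurableSpace C] in
/-- ★ **The transport defect is the kinetic Gram form of the weighted-profile difference**: with `d = m_cΩ_c − m_{c'}Ω_{c'}` and `G(q,q') = ∫ g(q,z)g(q',z)dρ`,
`transportSq Ω c c' = ∫∫ d(q)G(q,q')d(q') dπdπ`. [folklore] -/
theorem transportSq_eq_form_of_mul (hs : ∀ c q z, s c q z = m c q * g q z) (c c' : C)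
    (h1 : ∀ z, Integrable (fun q => s c q z * Ω c q) π) (h2 : ∀ z, Integrable (fun q => s c' q z * Ω c' q) π)
    (hG : Integrable (fun w : (Q × Q) × Z => (g w.1.1 w.2 * (m c w.1.1 * Ω c w.1.1 - m c' w.1.1 * Ω c' w.1.1)) *
      (g w.1.2 w.2 * (m c w.1.2 * Ω c w.1.2 - m c' w.1.2 * Ω c' w.1.2))) ((π.prod π).prod ρ)) :
    transportSq π ρ s Ω c c' =
      ∫ q, ∫ q', (m c q * Ω c q - m c' q * Ω c' q) * gramKernel ρ (fun (_ : C) q z => g q z) c c q q' * (m c q' * Ω c q' - m c' q' * Ω c' q') ∂π ∂π := by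
  -- the defect is the frozen energy of `d` for the `c`-independent half-kernel `g`
  have e : transportSq π ρ s Ω c c' = fibrePair π ρ (fun (_ : C) q z => g q z) c c (fun q => m c q * Ω c q - m c' q * Ω c' q)
      (fun q => m c q * Ω c q - m c' q * Ω c' q) := by
    unfold transportSq fibrePair
    refine integral_congr_ae (ae_of_all _ fun z => ?_)
    dsimp only
    have : halfT π (fun (_ : C) q z => g q z) c (fun q => m c q * Ω c q - m c' q * Ω c' q) z = ∫ q, g q z * (m c q * Ω c q - m c' q * Ω c' q) ∂π := rfl
    rw [this, ← halfT_sub_halfT_of_mul hs c c' z (h1 z) (h2 z)]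
    ring
  rw [e]
  exact (integral_gramKernel_eq_fibrePair (π := π) (ρ := ρ) (s := fun (_ : C) q z => g q z) c c _ _ hG).symm

omit [MeasurableSpace C] in
/-- ★★ **`L²`-Lipschitz bound of the transport defect**: if the kinetic Gram kernel `G(q,q') = ∫ g(q,z)g(q',z)dρ` is nonnegative with row integrals `≤ M_G`
(it is symmetric by construction), then `transportSq Ω c c' ≤ M_G·∫ (m_cΩ_c − m_{c'}Ω_{c'})² dπ`.  (For the Gaussian half-kernel `g(q,z) = e^{−2b‖q−z‖²}` on `ℝⁿ`:
`G = (π/4b)^{n/2}e^{−b‖q−q'‖²}`, `M_G = (π/4b)^{n/2}(π/b)^{n/2}`.) [cite: Helffer2013, Lemma 7.1 pp.77–78] -/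
theorem transportSq_le_of_mul (hs : ∀ c q z, s c q z = m c q * g q z) (c c' : C) {M : ℝ}
    (hg0 : ∀ q q', 0 ≤ gramKernel ρ (fun (_ : C) q z => g q z) c c q q')
    (hrow : ∀ᵐ q ∂π, ∫ q', gramKernel ρ (fun (_ : C) q z => g q z) c c q q' ∂π ≤ M)
    (h1 : ∀ z, Integrable (fun q => s c q z * Ω c q) π) (h2 : ∀ z, Integrable (fun q => s c' q z * Ω c' q) π)
    (hG : Integrable (fun w : (Q × Q) × Z => (g w.1.1 w.2 * (m c w.1.1 * Ω c w.1.1 - m c' w.1.1 * Ω c' w.1.1)) *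
      (g w.1.2 w.2 * (m c w.1.2 * Ω c w.1.2 - m c' w.1.2 * Ω c' w.1.2))) ((π.prod π).prod ρ))
    (hd2 : Integrable (fun q => (m c q * Ω c q - m c' q * Ω c' q) ^ 2) π)
    (hI : Integrable (fun p : Q × Q => (m c p.1 * Ω c p.1 - m c' p.1 * Ω c' p.1) * gramKernel ρ (fun (_ : C) q z => g q z) c c p.1 p.2 *
      (m c p.2 * Ω c p.2 - m c' p.2 * Ω c' p.2)) (π.prod π))
    (hI₁ : Integrable (fun p : Q × Q => gramKernel ρ (fun (_ : C) q z => g q z) c c p.1 p.2 * (m c p.1 * Ω c p.1 - m c' p.1 * Ω c' p.1) ^ 2) (π.prod π))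
    (hI₂ : Integrable (fun p : Q × Q => gramKernel ρ (fun (_ : C) q z => g q z) c c p.1 p.2 * (m c p.2 * Ω c p.2 - m c' p.2 * Ω c' p.2) ^ 2) (π.prod π)) :
    transportSq π ρ s Ω c c' ≤ M * ∫ q, (m c q * Ω c q - m c' q * Ω c' q) ^ 2 ∂π := by
  rw [transportSq_eq_form_of_mul hs c c' h1 h2 hG]
  have hsymm : ∀ q q', gramKernel ρ (fun (_ : C) q z => g q z) c c q q' = gramKernel ρ (fun (_ : C) q z => g q z) c c q' q := by
    intro q q'
    unfold gramKernel
    exact integral_congr_ae (ae_of_all _ fun z => mul_comm _ _)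
  exact Literature.Analysis.OperatorTheory.SchurTest.integral_integral_mul_kernel_mul_self_le_of_symm (μ := π)
    (fun q q' => gramKernel ρ (fun (_ : C) q z => g q z) c c q q') (fun q => m c q * Ω c q - m c' q * Ω c' q) hg0 hsymm hrow hd2 hI hI₁ hI₂

end Summit.QuantumFields.YangMills.Theorems.FemtoTransferGap.FibredBO

end
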